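import Literature.NumberTheory.EllipticCurves.AbelianVarietyModelOfAddHom
import HarnessLib

/-!
# Gluing the addition morphism of a Weierstrass cubic from local charts

Let `W` be an elliptic curve over a field `K`, `E_W ⊂ ℙ²_K` its plane cubic (`WeierstrassCurve.scheme`)
and `K̄ = AlgebraicClosure K`. Silverman, *AEC* III.3.6 proves that the chord–tangent law is a
morphism `E × E → E` by exhibiting it *locally* by rational formulas and gluing (loc. cit., proof, and
Remark 3.6.1; Bosma–Lenstra make the local formulas explicit). This file isolates the **gluing step**:

* `WeierstrassCurve.LawChart W` — a *law chart*: an affine `K`-scheme `Spec S` with an open immersion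
  `ι : Spec S ↪ E_W ×_K E_W` over `K` and a `K`-morphism `μ : Spec S → E_W` which **computes the
  addition on `K̄`-points**: for every `K̄`-point `β` of `Spec S`, `μ(β) = pr₁(ι β) + pr₂(ι β)` in
  Mathlib's group `W(K̄)` (through the dictionary `W.toGeomPoint = pointEquiv⁻¹` of
  `EllipticCurves/WeierstrassSchemePoints` / `AbelianVarietyModelOfAddHom`);
* `WeierstrassCurve.AddAtlas W J` — a family of law charts whose sources cover `E_W ×_K E_W`;
* `AddAtlas.compatible` — **any two law charts agree on the overlap of their sources**: the overlap is
  a reduced `K`-scheme of finite type (an open of the integral `E_W ×_K E_W`), `E_W` is separated, and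
  two `K`-morphisms agreeing on `K̄`-points are equal (`Motives/AlgPointsSeparate`), while on
  `K̄`-points both charts give `pr₁ + pr₂`;
* `AddAtlas.addHom : E_W ×_K E_W → E_W` — the glued `K`-morphism (Mathlib `Scheme.Cover.glueMorphisms`),
  with `AddAtlas.toGeomPoint_addHom` / `AddAtlas.lift_pointEquiv_comp_addHom`: **on `K̄`-points it is
  the group law**, `⟨[P], [Q]⟩ ≫ addHom = [P + Q]` — exactly the hypothesis `hadd` of
  `EllipticCurves/AbelianVarietyModelOfAddHom` (`AddAtlas.exists_addHom`).

So an atlas of law charts for `W` (and the negation morphism of `EllipticCurves/WeierstrassSchemeNeg`)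
is all that the abelian-variety model of `W`, hence `nonempty_abelianVarietyBridge`, still requires.

## References

* J. H. Silverman, *The Arithmetic of Elliptic Curves*, 2nd ed., GTM 106 (2009): III.3.6 and its
  proof, Remark 3.6.1. [SilvermanAEC2009]
* W. Bosma, H. W. Lenstra, *Complete systems of two addition laws for elliptic curves*, J. Number
  Theory 53 (1995), 229–240. [BosmaLenstra1995]

## Design

`namespace WeierstrassCurve`; law charts carry scheme-level morphisms out of `Spec S` with their
`K`-structure equations (`ι_over`, `μ_over`), as Mathlib's gluing API is scheme-level; `K̄`-points of
`Spec S` over `K` are the `Spec β`, `β : S →ₐ[K] K̄` (`specPoint`, `exists_eq_specMap` via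
`WeierstrassCurve.algHomOfSpecMap`). No named facts.
-/

noncomputable section

open CategoryTheory AlgebraicGeometry MonoidalCategory CartesianMonoidalCategory Limits
open Literature.AlgebraicGeometry.Motives

universe u v

-- tree idiom for scheme-level rewriting through `Over`/pullback API (cf. `Motives/ProjSubscheme*`)
set_option backward.isDefEq.respectTransparency false

namespace WeierstrassCurve

variable {K : Type u} [Field K] (W : WeierstrassCurve K) [W.IsElliptic]

/-! ### Points of affine `K`-schemes mapping to a `K`-scheme -/

section SpecPoint

variable {W}
variable {X : SchemeOver K} {S : Type u} [CommRing S] [Algebra K S]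
  (f : Spec (CommRingCat.of S) ⟶ X.left)
  (hf : f ≫ X.hom = Spec.map (CommRingCat.ofHom (algebraMap K S)))
  {L : Type u} [Field L] [Algebra K L]

omit [W.IsElliptic] in
/-- The `L`-point `Spec L → Spec S → X` of `X` obtained from a morphism `f : Spec S → X` over `K` and an
`L`-point `β : S →ₐ[K] L` of `Spec S`. [folklore] -/
def specPoint (β : S →ₐ[K] L) : AlgPoints X L :=
  Over.homMk (Spec.map (CommRingCat.ofHom β.toRingHom) ≫ f) <| by
    change (Spec.map (CommRingCat.ofHom β.toRingHom) ≫ f) ≫ X.hom = Spec.map (CommRingCat.ofHom (algebraMap K L))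
    rw [Category.assoc, hf, ← Spec.map_comp, ← CommRingCat.ofHom_comp, AlgHom.toRingHom_eq_coe,
      AlgHom.comp_algebraMap]

omit [W.IsElliptic] in
/-- Underlying morphism of `specPoint` (`rfl`). [folklore] -/
@[simp]
theorem specPoint_left (β : S →ₐ[K] L) :
    (specPoint f hf β).left = Spec.map (CommRingCat.ofHom β.toRingHom) ≫ f := rfl

omit [W.IsElliptic] in
/-- **A morphism `Spec L → Spec S` over `K` is `Spec` of an `L`-point `β : S →ₐ[K] L`**
(`WeierstrassCurve.algHomOfSpecMap`). [folklore] -/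
theorem exists_eq_specMap (ℓ : Spec (CommRingCat.of L) ⟶ Spec (CommRingCat.of S))
    (hℓ : ℓ ≫ Spec.map (CommRingCat.ofHom (algebraMap K S)) = Spec.map (CommRingCat.ofHom (algebraMap K L))) :
    ∃ β : S →ₐ[K] L, ℓ = Spec.map (CommRingCat.ofHom β.toRingHom) :=
  ⟨algHomOfSpecMap ℓ hℓ, (specMap_algHomOfSpecMap ℓ hℓ).symm⟩

end SpecPoint

/-! ### Law charts -/

/-- **A law chart for the addition of `E_W`**: an affine open `ι : Spec S ↪ E_W ×_K E_W` over `K`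
with a `K`-morphism `μ : Spec S → E_W` computing the chord–tangent sum on `K̄`-points
(Silverman, *AEC* III.3.6, proof: "the addition is given locally by rational functions").
[cite: SilvermanAEC2009, III.3.6] -/
structure LawChart where
  /-- The coordinate ring of the source. -/
  S : Type u
  [commRing : CommRing S]
  [algebra : Algebra K S]
  /-- The open immersion of the source into `E_W ×_K E_W`. -/
  ι : Spec (CommRingCat.of S) ⟶ (W.scheme ⊗ W.scheme).left
  [isOpenImmersion : IsOpenImmersion ι]
  /-- `ι` is a morphism over `K`. -/
  ι_over : ι ≫ (W.scheme ⊗ W.scheme).hom = Spec.map (CommRingCat.ofHom (algebraMap K S))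
  /-- The value morphism `Spec S → E_W`. -/
  μ : Spec (CommRingCat.of S) ⟶ W.scheme.left
  /-- `μ` is a morphism over `K`. -/
  μ_over : μ ≫ W.scheme.hom = Spec.map (CommRingCat.ofHom (algebraMap K S))
  /-- The chart computes the addition on `K̄`-points. -/
  isAddition : ∀ β : S →ₐ[K] AlgebraicClosure K,
    W.toGeomPoint (specPoint μ μ_over β) =
      W.toGeomPoint (specPoint ι ι_over β ≫ fst W.scheme W.scheme) +
        W.toGeomPoint (specPoint ι ι_over β ≫ snd W.scheme W.scheme)

attribute [instance] LawChart.commRing LawChart.algebra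

/-- The source of a law chart is an open of `E_W ×_K E_W`. [folklore] -/
instance LawChart.isOpenImmersion_ι (L : W.LawChart) : IsOpenImmersion L.ι := L.isOpenImmersion

local notation "K̄" => AlgebraicClosure K

/-! ### Atlases and the glued addition -/

/-- **An atlas for the addition**: law charts whose sources cover `E_W ×_K E_W`
(Silverman, *AEC* III.3.6, proof; Bosma–Lenstra 1995 for explicit complete systems).
[cite: SilvermanAEC2009, III.3.6] -/
structure AddAtlas (J : Type v) where
  /-- The law charts. -/
  chart : J → W.LawChart
  /-- Their sources cover `E_W ×_K E_W`. -/
  covers : ∀ x : (W.scheme ⊗ W.scheme).left,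
    ∃ (j : J) (y : Spec (CommRingCat.of (chart j).S)), (chart j).ι y = x

namespace AddAtlas

variable {W} {J : Type v} (A : W.AddAtlas J)

/-- The open cover of `E_W ×_K E_W` by the sources of the charts. [folklore] -/
def cover : (W.scheme ⊗ W.scheme).left.OpenCover :=
  Scheme.Cover.mkOfCovers J (fun j ↦ Spec (CommRingCat.of (A.chart j).S)) (fun j ↦ (A.chart j).ι) A.covers

/-- The maps of the cover are the chart immersions (`rfl`). [folklore] -/
theorem cover_f (j : J) : A.cover.f j = (A.chart j).ι := rfl

/-- `E_W ×_K E_W` is an integral scheme (`W` elliptic). [folklore] -/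
theorem isIntegral_prod_left : AlgebraicGeometry.IsIntegral (W.scheme ⊗ W.scheme).left :=
  SchemeOver.isIntegral_left (W.scheme ⊗ W.scheme)

/-- **Two law charts agree on the overlap of their sources.** Both composites
`Spec Sⱼ ×_{E×E} Spec Sₖ → Spec Sⱼ → E_W` and `→ Spec Sₖ → E_W` are `K`-morphisms from a reduced
`K`-scheme of finite type to the separated `E_W` taking the same values `pr₁ + pr₂` on `K̄`-points,
hence are equal (`SchemeOver.hom_ext_of_forall_algPoints`). [cite: SilvermanAEC2009, III.3.6] -/
theorem compatible (j k : J) :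
    pullback.fst (A.chart j).ι (A.chart k).ι ≫ (A.chart j).μ =
      pullback.snd (A.chart j).ι (A.chart k).ι ≫ (A.chart k).μ := by
  set Lj := A.chart j
  set Lk := A.chart k
  haveI : AlgebraicGeometry.IsIntegral (W.scheme ⊗ W.scheme).left := isIntegral_prod_left
  -- the overlap as a `K`-scheme and the two maps as `K`-morphisms
  let P : SchemeOver K := Over.mk (pullback.fst Lj.ι Lk.ι ≫ Lj.ι ≫ (W.scheme ⊗ W.scheme).hom)
  haveI : AlgebraicGeometry.IsReduced P.left := isReduced_of_isOpenImmersion (pullback.fst Lj.ι Lk.ι ≫ Lj.ι)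
  haveI : LocallyOfFiniteType P.hom := by
    change LocallyOfFiniteType (pullback.fst Lj.ι Lk.ι ≫ Lj.ι ≫ (W.scheme ⊗ W.scheme).hom)
    infer_instance
  let f : P ⟶ W.scheme := Over.homMk (pullback.fst Lj.ι Lk.ι ≫ Lj.μ) (by
    change (pullback.fst Lj.ι Lk.ι ≫ Lj.μ) ≫ W.scheme.hom = pullback.fst Lj.ι Lk.ι ≫ Lj.ι ≫ _
    rw [Category.assoc, LawChart.μ_over, LawChart.ι_over])
  let g : P ⟶ W.scheme := Over.homMk (pullback.snd Lj.ι Lk.ι ≫ Lk.μ) (by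
    change (pullback.snd Lj.ι Lk.ι ≫ Lk.μ) ≫ W.scheme.hom = pullback.fst Lj.ι Lk.ι ≫ Lj.ι ≫ _
    rw [Category.assoc, LawChart.μ_over, ← LawChart.ι_over Lk, ← pullback.condition_assoc,
      LawChart.ι_over])
  suffices hfg : f = g from congrArg CommaMorphism.left hfg
  refine SchemeOver.hom_ext_of_forall_algPoints (AlgebraicClosure K) fun q ↦ ?_
  set ql : Spec (CommRingCat.of K̄) ⟶ pullback Lj.ι Lk.ι := q.left with hql
  have hq : ql ≫ pullback.fst Lj.ι Lk.ι ≫ Lj.ι ≫ (W.scheme ⊗ W.scheme).hom =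
      Spec.map (CommRingCat.ofHom (algebraMap K K̄)) := Over.w q
  -- the two points of the sources under `q`
  obtain ⟨βj, hβj⟩ := exists_eq_specMap (K := K) (ql ≫ pullback.fst Lj.ι Lk.ι) (by
    rw [Category.assoc, ← LawChart.ι_over]
    exact hq)
  obtain ⟨βk, hβk⟩ := exists_eq_specMap (K := K) (ql ≫ pullback.snd Lj.ι Lk.ι) (by
    rw [Category.assoc, ← LawChart.ι_over, ← pullback.condition_assoc]
    exact hq)
  -- the values
  have hvj : q ≫ f = specPoint Lj.μ Lj.μ_over βj := by
    refine Over.OverMorphism.ext ?_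
    rw [Over.comp_left, specPoint_left, ← hβj]
    rfl
  have hvk : q ≫ g = specPoint Lk.μ Lk.μ_over βk := by
    refine Over.OverMorphism.ext ?_
    rw [Over.comp_left, specPoint_left, ← hβk]
    rfl
  -- the two source points have the same image in `E ×_K E`
  have hsrc : specPoint Lj.ι Lj.ι_over βj = specPoint Lk.ι Lk.ι_over βk := by
    refine Over.OverMorphism.ext ?_
    rw [specPoint_left, specPoint_left, ← hβj, ← hβk, Category.assoc, Category.assoc, pullback.condition]
  apply W.toGeomPoint_bijective.1
  rw [hvj, hvk, Lj.isAddition βj, Lk.isAddition βk, hsrc]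

/-- `compatible`, stated for the maps of the cover. [folklore] -/
theorem compatible' (j k : A.cover.I₀) :
    pullback.fst (A.cover.f j) (A.cover.f k) ≫ (A.chart j).μ =
      pullback.snd (A.cover.f j) (A.cover.f k) ≫ (A.chart k).μ :=
  A.compatible j k

/-- The glued underlying morphism of schemes `E_W ×_K E_W → E_W` (Mathlib `Scheme.Cover.glueMorphisms`).
[cite: SilvermanAEC2009, III.3.6] -/
def addHomLeft : (W.scheme ⊗ W.scheme).left ⟶ W.scheme.left :=
  A.cover.glueMorphisms (fun j ↦ (A.chart j).μ) A.compatible'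

/-- The glued morphism restricted to the source of a chart is the value morphism. [folklore] -/
theorem ι_addHomLeft (j : J) : (A.chart j).ι ≫ A.addHomLeft = (A.chart j).μ :=
  A.cover.ι_glueMorphisms _ _ j

/-- The glued morphism is over `Spec K`. [folklore] -/
theorem addHomLeft_over : A.addHomLeft ≫ W.scheme.hom = (W.scheme ⊗ W.scheme).hom := by
  refine Scheme.Cover.hom_ext A.cover _ _ fun j ↦ ?_
  change (A.chart j).ι ≫ A.addHomLeft ≫ W.scheme.hom = (A.chart j).ι ≫ (W.scheme ⊗ W.scheme).hom
  rw [← Category.assoc, ι_addHomLeft, LawChart.μ_over, LawChart.ι_over]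

/-- **The addition morphism `E_W ×_K E_W → E_W` over `K` glued from an atlas of law charts**
(Silverman, *AEC* III.3.6). [cite: SilvermanAEC2009, III.3.6] -/
def addHom : W.scheme ⊗ W.scheme ⟶ W.scheme :=
  Over.homMk A.addHomLeft A.addHomLeft_over

/-- The addition restricted to the source of a chart is the value morphism. [folklore] -/
theorem ι_comp_addHom_left (j : J) : (A.chart j).ι ≫ A.addHom.left = (A.chart j).μ :=
  A.ι_addHomLeft j

/-- Every point of `Spec` of a field is its closed point. [folklore] -/
theorem eq_closedPoint (s : Spec (CommRingCat.of K̄)) : s = IsLocalRing.closedPoint K̄ :=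
  Subsingleton.elim _ _

/-- **The glued addition is the group law on `K̄`-points**: for every `K̄`-point `p` of
`E_W ×_K E_W`, `addHom (p) = pr₁ p + pr₂ p` in `W(K̄)` (the point lies in the source of some chart,
which computes the addition). [cite: SilvermanAEC2009, III.3.6] -/
theorem toGeomPoint_addHom (p : AlgPoints (W.scheme ⊗ W.scheme) K̄) :
    W.toGeomPoint (p ≫ A.addHom) =
      W.toGeomPoint (p ≫ fst W.scheme W.scheme) + W.toGeomPoint (p ≫ snd W.scheme W.scheme) := by
  set pl : Spec (CommRingCat.of K̄) ⟶ (W.scheme ⊗ W.scheme).left := p.left with hpl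
  obtain ⟨j, y, hy⟩ := A.covers (pl (IsLocalRing.closedPoint K̄))
  have hrange : Set.range pl ⊆ Set.range (A.chart j).ι := by
    rintro _ ⟨s, hs⟩
    rw [← hs, eq_closedPoint s]
    exact ⟨y, hy⟩
  let ℓ : Spec (CommRingCat.of K̄) ⟶ Spec (CommRingCat.of (A.chart j).S) := IsOpenImmersion.lift (A.chart j).ι pl hrange
  have hℓ : ℓ ≫ (A.chart j).ι = pl := IsOpenImmersion.lift_fac _ _ _
  have hpo : pl ≫ (W.scheme ⊗ W.scheme).hom = Spec.map (CommRingCat.ofHom (algebraMap K K̄)) := Over.w p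
  obtain ⟨β, hβ⟩ := exists_eq_specMap (K := K) ℓ (by
    rw [← LawChart.ι_over, ← Category.assoc, hℓ]
    exact hpo)
  have hp : p = specPoint (A.chart j).ι (A.chart j).ι_over β := by
    refine Over.OverMorphism.ext ?_
    rw [specPoint_left, ← hβ, hℓ]
  have hval : p ≫ A.addHom = specPoint (A.chart j).μ (A.chart j).μ_over β := by
    refine Over.OverMorphism.ext ?_
    rw [Over.comp_left, specPoint_left, ← hβ]
    change pl ≫ A.addHom.left = ℓ ≫ (A.chart j).μ
    rw [← hℓ, Category.assoc, ι_comp_addHom_left]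
  rw [hval, (A.chart j).isAddition β, ← hp]

/-- **`⟨[P], [Q]⟩ ≫ addHom = [P + Q]`**: the glued addition in the form consumed by
`EllipticCurves/AbelianVarietyModelOfAddHom` (`hadd`). [cite: SilvermanAEC2009, III.3.6] -/
theorem lift_pointEquiv_comp_addHom (P Q : W.geomPoints) :
    lift (W.pointEquiv (L := K̄) P) (W.pointEquiv (L := K̄) Q) ≫ A.addHom =
      W.pointEquiv (L := K̄) (P + Q) := by
  have h := A.toGeomPoint_addHom (lift (W.pointEquiv (L := K̄) P) (W.pointEquiv (L := K̄) Q))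
  rw [lift_fst, lift_snd, toGeomPoint_pointEquiv, toGeomPoint_pointEquiv] at h
  rw [← W.pointEquiv_toGeomPoint (lift (W.pointEquiv (L := K̄) P) (W.pointEquiv (L := K̄) Q) ≫ A.addHom), h]

include A in
/-- **An atlas of law charts yields the addition morphism with its values on `K̄`-points.**
[cite: SilvermanAEC2009, III.3.6] -/
theorem exists_addHom :
    ∃ add : W.scheme ⊗ W.scheme ⟶ W.scheme, ∀ P Q : W.geomPoints,
      lift (W.pointEquiv (L := K̄) P) (W.pointEquiv (L := K̄) Q) ≫ add = W.pointEquiv (L := K̄) (P + Q) :=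
  ⟨A.addHom, A.lift_pointEquiv_comp_addHom⟩

end AddAtlas

end WeierstrassCurve
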